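import Summits.ResolutionOfSingularities.ResolutionOfSingularities.Theorems.WildASPairLU4
import HarnessLib

/-!
# WildASPairLU (5/5) — PLACE LEVEL: the kind `λ₂^{AS}` COLLAPSES into `λ′ ∪ PR` (both DECIDED)

Node «ASPairCollapse» (decomp-res lens-1 g35), tree file 5/5 — a 0-WEIGHT KERNEL STRUCTURE (critic letter 239c:
the Artin–Schreier-pair sub-kind `WildLogASPairAbove` of the door `λ₂ = WildLogRankTwoAbove` lies, BY THE THEOREM OF
THIS FILE, inside the union of two kinds already negated in the located residual `R35 =
NonKHToricArchLUKeyHenselDescentQuotTInertTwoMBWildLDTTCy` — no new residual, no tally change; registry word «AS pairs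
COLLAPSE: KERNEL»).
* `exists_collapse_modelAbove` — the engine `asPair_collapse` (file 4) run on a `G`-stable model `ι(R)[t₀]` of a
  prime-degree Galois extension: the new model is `ι(R)[t₀ ∪ s]`, `G`-stable because `G = ⟨g⟩` (`g` moves `x′_{j₁}`).
* `unlucky_or_pseudoReflection_of_wildLogASPairAbove` — PLACE LEVEL, hypothesis-free:
  `WildLogASPairAbove k O → WildLogDiagonalUnluckyAbove k O ∨ WildPseudoReflectionLUAbove k O` (models are directed:
  if some `R₀` has no `λ′`-model, the collapse above `R ⊔ R₀` is a pseudo-reflection above `R`).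
* `relLU_of_wildLogASPairAbove` — the LAW of the sub-kind (corollary of the two landed laws), and
  `not_wildLogASPairAbove` — its LOCATION inside `R35`'s negated kinds.
HONEST SCOPE.  Decided here: AS-pair frames (`u_{j_i} = (1 + x′_{j_i})⁻¹` for two frame coordinates in the model,
all frame units monomials in the two).  NOT decided: the rest of `λ₂` — mixed AS pairs `u = (1+x′_{j₁})^a(1+x′_{j₂})^b·
(unit ≡ 1 mod (x′_{j₁}, x′_{j₂})²)` (`λ₂^{mAS}`, next door) and PENCIL pairs `g x_i = x_i/(1 + x_i F_i)` with `F_i`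
non-monomial (their collapse is embedded local uniformization of `{F₁F₂ = 0}` — the wall).
-/

noncomputable section

open IsLocalRing IntermediateField Literature.AlgebraicGeometry.Resolution
open Summit.ResolutionOfSingularities.ResolutionOfSingularities.Theorems.WildReflectionLU
open Summit.ResolutionOfSingularities.ResolutionOfSingularities.Theorems.WildLogDiagonalLU
open Summit.ResolutionOfSingularities.ResolutionOfSingularities.Theorems.TameQuotientLU
open Summit.ResolutionOfSingularities.ResolutionOfSingularities.Theorems.WildTwistedToricLU
open Summit.ResolutionOfSingularities.ResolutionOfSingularities.Theorems.WildCocycleLU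

namespace Summit.ResolutionOfSingularities.ResolutionOfSingularities.Theorems.WildASPairLU

section Place

variable (k : Type) [Field k] {K : Type} [Field K] [Algebra k K]

variable {k}

set_option maxHeartbeats 1600000 in
/-- **THE ENGINE ON A GALOIS MODEL.**  `K′/K` Galois of prime degree `p`, `O′` `G`-stable with residues in `k`,
`M = ι(R)[t₀] ⊆ O′` a `G`-stable model regular at the centre carrying an AS-pair frame for `g ∈ G`: then some
`ι(R)[t₀ ∪ s]` is `G`-stable and carries `CollapseData` for `g` (file 4).  Plumbing: `S′ = ι(R)` is Noetherian and
universally catenary (f.g. over a field), fixed by `g`, with residues; `g^p = 1` (`IsGalois.card_aut_eq_finrank`);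
`g ≠ 1` since it moves `x′_{j₁}`, so `G = ⟨g⟩` (`mem_powers_of_prime_card`) and `g`-stability is `G`-stability.
[this node] -/
theorem exists_collapse_modelAbove {K' : IntermediateField K (AlgebraicClosure K)} [FiniteDimensional K K']
    [IsGalois K K'] (hprime : (Module.finrank K K').Prime) {O' : ValuationSubring K'}
    (hGO' : ∀ g : K' ≃ₐ[K] K', ∀ y : K', y ∈ O' ↔ g y ∈ O')
    (hκ' : ∀ y ∈ O', ∃ c : k, y - algebraMap k K' c ∈ O'.nonunits)
    {R : Subalgebra k K} (hRfg : R.FG) {t₀ : Finset K'}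
    (hMO : modelAbove k R K' t₀ ≤ O'.toSubring)
    (hGM : ∀ g : K' ≃ₐ[K] K', ∀ y ∈ modelAbove k R K' t₀, g y ∈ modelAbove k R K' t₀)
    (hMreg : IsRegularLocalRing (locAtCentre (modelAbove k R K' t₀) O'))
    {d : ℕ} {x x' : Fin d → K'} {A : Fin d → Fin d → ℕ} {g : K' ≃ₐ[K] K'} {j₁ j₂ : Fin d}
    {N₁ N₂ : Fin d → ℤ}
    (hdim : ringKrullDim (locAtCentre (modelAbove k R K' t₀) O') = d)
    (hx : ∀ i, x i ∈ locAtCentre (modelAbove k R K' t₀) O' ∧ O'.valuation (x i) < 1)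
    (hgen : ∀ b ∈ locAtCentre (modelAbove k R K' t₀) O', O'.valuation b < 1 →
      ∃ c : Fin d → K', (∀ i, c i ∈ locAtCentre (modelAbove k R K' t₀) O') ∧ b = ∑ i, c i * x i)
    (hx' : ∀ j, x' j ≠ 0 ∧ x' j ∈ O' ∧ O'.valuation (x' j) < 1 ∧
      ∃ a b : K', a ∈ modelAbove k R K' t₀ ∧ b ∈ modelAbove k R K' t₀ ∧ x' j = a / b)
    (hmon : ∀ i, x i = ∏ j, x' j ^ A i j) (h12 : x' j₁ ≠ x' j₂)
    (hx'M : x' j₁ ∈ modelAbove k R K' t₀ ∧ x' j₂ ∈ modelAbove k R K' t₀)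
    (hN : N₁ j₁ = -1 ∧ N₂ j₁ = 0 ∧ N₁ j₂ = 0 ∧ N₂ j₂ = -1)
    (htw : ∀ j, g (x' j) = x' j * (1 + x' j₁) ^ N₁ j * (1 + x' j₂) ^ N₂ j) :
    ∃ t : Finset K', (∀ g' : K' ≃ₐ[K] K', ∀ y ∈ modelAbove k R K' t, g' y ∈ modelAbove k R K' t) ∧
      CollapseData O' (g : K' ≃+* K') (modelAbove k R K' t) d := by
  classical
  set p : ℕ := Module.finrank K K' with hpdef
  haveI hpF : Fact p.Prime := ⟨hprime⟩
  let ι : K →+* K' := (algebraMap K K' : K →+* K')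
  have hgf : ∀ (g : K' ≃ₐ[K] K') (x : K), g (ι x) = ι x := fun g x => g.commutes x
  have hfk : ∀ c : k, ι (algebraMap k K c) = algebraMap k K' c := fun c =>
    (IsScalarTower.algebraMap_apply k K K' c).symm
  have hcoe1 : ((1 : K' ≃ₐ[K] K') : K' ≃+* K') = 1 := RingEquiv.ext fun _ => rfl
  have hcoemul : ∀ g g' : K' ≃ₐ[K] K', ((g * g' : K' ≃ₐ[K] K') : K' ≃+* K') =
      (g : K' ≃+* K') * (g' : K' ≃+* K') := fun _ _ => RingEquiv.ext fun _ => rfl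
  have hcoepow : ∀ (g : K' ≃ₐ[K] K') (n : ℕ), ((g ^ n : K' ≃ₐ[K] K') : K' ≃+* K') = (g : K' ≃+* K') ^ n := by
    intro g n
    induction n with
    | zero => rw [pow_zero, pow_zero, hcoe1]
    | succ n ih => rw [pow_succ, pow_succ, hcoemul, ih]
  -- the model `M = ι(R)[t₀]` over the constants `S′ = ι(R)`
  set S' : Subring K' := R.toSubring.map ι with hS'def
  set M : Subring K' := modelAbove k R K' t₀ with hMdef
  have hMgen : M = Subring.closure ((S' : Set K') ∪ (t₀ : Set K')) := rfl
  have hS'M : S' ≤ M := fun w hw => Subring.subset_closure (Or.inl hw)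
  have hRS : ∀ x ∈ R, ι x ∈ S' := fun x hx => Subring.mem_map.mpr ⟨x, hx, rfl⟩
  have hkS : ∀ c : k, algebraMap k K' c ∈ S' := fun c => by
    rw [← hfk]; exact hRS _ (R.algebraMap_mem c)
  have hσS : ∀ w ∈ S', (g : K' ≃+* K') w = w := by
    intro w hw
    obtain ⟨x, -, rfl⟩ := Subring.mem_map.mp hw
    exact hgf g x
  haveI : Algebra.FiniteType k R := (Subalgebra.fg_iff_finiteType R).mp hRfg
  haveI : IsNoetherianRing R := Algebra.FiniteType.isNoetherianRing k R
  haveI hS'noeth : IsNoetherianRing S' :=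
    isNoetherianRing_of_surjective R S' (ι.restrict R S' hRS) (by
      rintro ⟨w, hw⟩
      obtain ⟨x, hx, rfl⟩ := Subring.mem_map.mp hw
      exact ⟨⟨x, hx⟩, rfl⟩)
  have hSuc : IsUniversallyCatenaryRing S' :=
    (isUniversallyCatenaryRing_of_finiteType_field k R).of_surjective (ι.restrict R S' hRS) (by
      rintro ⟨y, hy⟩
      obtain ⟨z, hz, rfl⟩ := Subring.mem_map.mp hy
      exact ⟨⟨z, hz⟩, rfl⟩)
  have hresO : ∀ y ∈ O', ∃ c ∈ S', O'.valuation (y - c) < 1 := fun y hy => by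
    obtain ⟨c, hc⟩ := hκ' y hy
    exact ⟨algebraMap k K' c, hkS c, (O'.mem_nonunits_iff).mp hc⟩
  have hTuc : IsUniversallyCatenaryRing (locAtCentre M O') :=
    isUniversallyCatenaryRing_locAtCentre_closure O' S' hSuc t₀ hMO
  -- the datum `σ = g`: `σ^p = 1`, `g ≠ 1`
  set σ : K' ≃+* K' := (g : K' ≃+* K') with hσdef
  have hσO : ∀ z : K', z ∈ O' ↔ σ z ∈ O' := hGO' g
  have hcard : Nat.card (K' ≃ₐ[K] K') = p := IsGalois.card_aut_eq_finrank K K'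
  have hσp : σ ^ p = 1 := by
    have hgp : g ^ p = 1 := by rw [← hcard]; exact pow_card_eq_one'
    rw [hσdef, ← hcoepow, hgp, hcoe1]
  have hσM : ∀ z ∈ M, σ z ∈ M := hGM g
  have htw' : ∀ j, σ (x' j) = x' j * (1 + x' j₁) ^ N₁ j * (1 + x' j₂) ^ N₂ j := htw
  have hg1 : g ≠ 1 := by
    rintro rfl
    have e : x' j₁ = x' j₁ * (1 + x' j₁) ^ N₁ j₁ * (1 + x' j₂) ^ N₂ j₁ := by rw [← htw j₁]; rfl
    rw [hN.1, hN.2.1, zpow_zero, mul_one, zpow_neg, zpow_one] at e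
    have h1 : (1 + x' j₁)⁻¹ = 1 := mul_left_cancel₀ (hx' j₁).1 (e.symm.trans (mul_one _).symm)
    rw [inv_eq_one] at h1
    exact (hx' j₁).1 (by linear_combination h1)
  -- THE ENGINE (file 4)
  obtain ⟨s, hsfin, hT'O, hσT', hreg', hdata⟩ := asPair_collapse O' p hσO hσp hS'M hσS hMO hσM hMreg hTuc
    hresO hdim hx hgen hx' hmon h12 hx'M hN htw'
  -- `M[s] = ι(R)[t₀ ∪ s]`
  have hEq : modelAbove k R K' (t₀ ∪ hsfin.toFinset) = Subring.closure ((M : Set K') ∪ s) := by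
    show Subring.closure ((S' : Set K') ∪ ((t₀ ∪ hsfin.toFinset : Finset K') : Set K')) = _
    rw [hMgen, closure_closure_union, Finset.coe_union, Set.Finite.coe_toFinset, Set.union_assoc]
  refine ⟨t₀ ∪ hsfin.toFinset, fun g' z hz => ?_, ?_⟩
  · -- `G = ⟨g⟩`: `g`-stability is `G`-stability
    obtain ⟨m, rfl⟩ := (Submonoid.mem_powers_iff _ _).mp (mem_powers_of_prime_card hcard hg1 (g' := g'))
    rw [hEq] at hz ⊢
    induction m generalizing z with
    | zero => rw [pow_zero, AlgEquiv.one_apply]; exact hz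
    | succ m ih => rw [pow_succ, AlgEquiv.mul_apply]; exact ih _ (hσT' z hz)
  · rw [hEq]; exact ⟨hT'O, hσT', hreg', hdata⟩

set_option maxHeartbeats 1600000 in
/-- **PLACE-LEVEL COLLAPSE OF THE ARTIN–SCHREIER PAIRS** (hypothesis-free, every `d`, every `p`):
`WildLogASPairAbove k O → WildLogDiagonalUnluckyAbove k O ∨ WildPseudoReflectionLUAbove k O`.
If above EVERY f.g. birational `R` some `G`-stable model carries a `λ′`-frame, the place is `λ′`.  Otherwise some
`R₀` has none; above any `R` run the engine on the AS-pair model above the JOIN `R ⊔ R₀` (`modelAbove_sup_adjoin_eq`):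
its output is a model above `R₀`, so it is not a `λ′`-frame, hence a pseudo-reflection — on a model above `R`.
Both target kinds are DECIDED in the tree (`relLU_of_wildLogDiagonalUnluckyAbove`, `relLU_of_wildPseudoReflectionLUAbove`)
and NEGATED among the binders of `R35`: the sub-kind is located, not a new place (0-weight kernel structure). [this node] -/
theorem unlucky_or_pseudoReflection_of_wildLogASPairAbove {O : ValuationSubring K}
    (h : WildLogASPairAbove k O) : WildLogDiagonalUnluckyAbove k O ∨ WildPseudoReflectionLUAbove k O := by
  classical
  obtain ⟨K', hfd, hgal, hprime, hchar, O', hO'O, hGO', hκ', hLU⟩ := h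
  haveI := hfd
  haveI := hgal
  -- per-model collapse above every f.g. birational `R₁`
  have key : ∀ R₁ : Subalgebra k K, R₁.FG → IsFractionRing R₁ K → R₁.toSubring ≤ O.toSubring →
      ∃ t : Finset K', ∃ d : ℕ, ∃ g : K' ≃ₐ[K] K',
        (∀ g' : K' ≃ₐ[K] K', ∀ y ∈ modelAbove k R₁ K' t, g' y ∈ modelAbove k R₁ K' t) ∧
        CollapseData O' (g : K' ≃+* K') (modelAbove k R₁ K' t) d := by
    intro R₁ hR₁fg hR₁frac hR₁O
    obtain ⟨t₁, hMO, hGM, hMreg, d, x, x', A, g, j₁, j₂, N₁, N₂, hdim, hx, hgen, hx', hmon,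
      ⟨h12, hj₁M, hj₂M, hN⟩, htw⟩ := hLU R₁ hR₁fg hR₁frac hR₁O
    obtain ⟨t, hGM', hdata⟩ := exists_collapse_modelAbove hprime hGO' hκ' hR₁fg hMO hGM hMreg hdim hx hgen
      hx' hmon h12 ⟨hj₁M, hj₂M⟩ hN htw
    exact ⟨t, d, g, hGM', hdata⟩
  by_cases hall : ∀ R : Subalgebra k K, R.FG → IsFractionRing R K → R.toSubring ≤ O.toSubring →
      ∃ t₀ : Finset K', modelAbove k R K' t₀ ≤ O'.toSubring ∧
        (∀ g : K' ≃ₐ[K] K', ∀ y ∈ modelAbove k R K' t₀, g y ∈ modelAbove k R K' t₀) ∧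
        IsRegularLocalRing (locAtCentre (modelAbove k R K' t₀) O') ∧
        ∃ d : ℕ, ∃ x x' : Fin d → K', ∃ A : Fin d → Fin d → ℕ, ∃ η w : K', ∃ a' : Fin d → ℕ,
        ∃ g : K' ≃ₐ[K] K', ∃ N : Fin d → ℤ,
          ringKrullDim (locAtCentre (modelAbove k R K' t₀) O') = d ∧
          (∀ i, x i ∈ locAtCentre (modelAbove k R K' t₀) O' ∧ O'.valuation (x i) < 1) ∧
          (∀ b ∈ locAtCentre (modelAbove k R K' t₀) O', O'.valuation b < 1 →
            ∃ c : Fin d → K', (∀ i, c i ∈ locAtCentre (modelAbove k R K' t₀) O') ∧ b = ∑ i, c i * x i) ∧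
          (∀ j, x' j ≠ 0 ∧ x' j ∈ O' ∧ O'.valuation (x' j) < 1 ∧
            ∃ a b : K', a ∈ modelAbove k R K' t₀ ∧ b ∈ modelAbove k R K' t₀ ∧ x' j = a / b) ∧
          (∀ i, x i = ∏ j, x' j ^ A i j) ∧
          (η ∈ modelAbove k R K' t₀ ∧ O'.valuation η < 1 ∧ w ∈ locAtCentre (modelAbove k R K' t₀) O' ∧
            O'.valuation w = 1 ∧ η = w * ∏ j, x' j ^ a' j) ∧
          (∀ j, g (x' j) = x' j * (1 + η) ^ (N j)) ∧
          ∃ j, N j ≠ 0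
  · exact Or.inl ⟨K', hfd, hgal, hprime, hchar, O', hO'O, hGO', hκ', hall⟩
  right
  obtain ⟨R₀, hR₀⟩ := not_forall.mp hall
  obtain ⟨hR₀fg, hR₀⟩ := Classical.not_imp.mp hR₀
  obtain ⟨hR₀frac, hR₀⟩ := Classical.not_imp.mp hR₀
  obtain ⟨hR₀O, hnone⟩ := Classical.not_imp.mp hR₀
  obtain ⟨s₀, rfl⟩ := hR₀fg
  refine ⟨K', hfd, hgal, hprime, hchar, O', hO'O, hGO', fun R hRfg hRfrac hRO => ?_⟩
  obtain ⟨s, rfl⟩ := hRfg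
  let ι : K →+* K' := (algebraMap K K' : K →+* K')
  -- the JOIN of the two models
  have hkO : ∀ c : k, algebraMap k K c ∈ O.toSubring := fun c =>
    hRO ((Algebra.adjoin k (s : Set K)).algebraMap_mem c)
  let Ok : Subalgebra k K :=
    { carrier := {y | y ∈ O.toSubring}
      mul_mem' := fun {a b} ha hb => O.toSubring.mul_mem ha hb
      one_mem' := O.toSubring.one_mem
      add_mem' := fun {a b} ha hb => O.toSubring.add_mem ha hb
      zero_mem' := O.toSubring.zero_mem
      algebraMap_mem' := hkO }
  set R₁ : Subalgebra k K := Algebra.adjoin k (s : Set K) ⊔ Algebra.adjoin k (s₀ : Set K) with hR₁def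
  have hR₁fg : R₁.FG := (Subalgebra.fg_adjoin_finset s).sup (Subalgebra.fg_adjoin_finset s₀)
  have hR₁frac : IsFractionRing R₁ K := isFractionRing_of_le le_sup_left hRfrac
  have hR₁Ok : R₁ ≤ Ok := sup_le (fun y hy => hRO hy) (fun y hy => hR₀O hy)
  have hR₁O : R₁.toSubring ≤ O.toSubring := fun y hy => hR₁Ok hy
  obtain ⟨t₁, d, g, hGM, hMO, -, hreg, hdata⟩ := key R₁ hR₁fg hR₁frac hR₁O
  rcases hdata with ⟨x, x', A, η, w, a', N, h1, h2, h3, h4, h5, h6, h7, h8⟩ | ⟨y, hy, hmv, haug⟩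
  · -- a `λ′`-frame above `R ⊔ R₀` is one above `R₀`: contradiction
    exfalso
    refine hnone ⟨t₁ ∪ s.image ι, ?_⟩
    have hEq : modelAbove k (Algebra.adjoin k (s₀ : Set K)) K' (t₁ ∪ s.image ι) = modelAbove k R₁ K' t₁ := by
      rw [hR₁def, sup_comm]
      exact (modelAbove_sup_adjoin_eq k (Algebra.adjoin k (s₀ : Set K)) s K' t₁).symm
    rw [hEq]
    exact ⟨hMO, hGM, hreg, d, x, x', A, η, w, a', g, N, h1, h2, h3, h4, h5, h6, h7, h8⟩
  · -- a pseudo-reflection above `R ⊔ R₀` is one above `R`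
    refine ⟨t₁ ∪ s₀.image ι, ?_⟩
    have hEq : modelAbove k (Algebra.adjoin k (s : Set K)) K' (t₁ ∪ s₀.image ι) = modelAbove k R₁ K' t₁ :=
      (modelAbove_sup_adjoin_eq k (Algebra.adjoin k (s : Set K)) s₀ K' t₁).symm
    rw [hEq]
    exact ⟨hMO, hGM, hreg, g, y, hy, hmv, haug⟩

/-- **THE LAW OF THE SUB-KIND `λ₂^{AS}`** (hypothesis-free, every `d`, every `p`; a COROLLARY of the collapse and
the two landed laws — 0-weight per critic letter 239c / RULE cn42, since `λ₂^{AS} ⊆ λ′ ∪ PR` provably):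
`WildLogASPairAbove k O → RelLocalUniformization k K O`. [this node] -/
theorem relLU_of_wildLogASPairAbove {O : ValuationSubring K} (h : WildLogASPairAbove k O) :
    RelLocalUniformization k K O :=
  (unlucky_or_pseudoReflection_of_wildLogASPairAbove h).elim relLU_of_wildLogDiagonalUnluckyAbove
    relLU_of_wildPseudoReflectionLUAbove

/-- **LOCATION.**  Under the binders `¬ WildLogDiagonalUnluckyAbove`, `¬ WildPseudoReflectionLUAbove` of the
located residual `R35` there is NO Artin–Schreier-pair place: the sub-kind `λ₂^{AS}` of the door `λ₂` is EMPTY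
inside `R35` — the door's genuinely open part starts at the MIXED AS pairs `λ₂^{mAS}` and the pencil pairs. [this node] -/
theorem not_wildLogASPairAbove {O : ValuationSubring K} (h₁ : ¬ WildLogDiagonalUnluckyAbove k O)
    (h₂ : ¬ WildPseudoReflectionLUAbove k O) : ¬ WildLogASPairAbove k O := fun h =>
  (unlucky_or_pseudoReflection_of_wildLogASPairAbove h).elim h₁ h₂

/-- Fully-qualified audit example: the collapse, stated over the landed kinds verbatim. -/
example {O : ValuationSubring K}
    (h : Summit.ResolutionOfSingularities.ResolutionOfSingularities.Theorems.WildASPairLU.WildLogASPairAbove k O) :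
    Summit.ResolutionOfSingularities.ResolutionOfSingularities.Theorems.WildLogDiagonalLU.WildLogDiagonalUnluckyAbove
        k O ∨
      Summit.ResolutionOfSingularities.ResolutionOfSingularities.Theorems.WildReflectionLU.WildPseudoReflectionLUAbove
        k O :=
  unlucky_or_pseudoReflection_of_wildLogASPairAbove h

/-- Fully-qualified audit example: the law of the sub-kind. -/
example {O : ValuationSubring K}
    (h : Summit.ResolutionOfSingularities.ResolutionOfSingularities.Theorems.WildASPairLU.WildLogASPairAbove k O) :
    Literature.AlgebraicGeometry.Resolution.RelLocalUniformization k K O :=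
  relLU_of_wildLogASPairAbove h

/-- Control: the sub-kind sits inside the mixed-unit kind `λ″` (file 1) — it is a sub-kind of the log-diagonal
world carved in `WildCocycleLU3` (`λ″ = λ₁ ∪ λ₂`), not a new world. -/
example {O : ValuationSubring K} (h : WildLogASPairAbove k O) :
    WildCocycleLU.WildLogCyclicAbove k O ∨ WildCocycleLU.WildLogRankTwoAbove k O :=
  wildLogCyclicAbove_or_wildLogRankTwoAbove (wildLogDiagonalMixedAbove_of_wildLogASPairAbove h)

end Place

end Summit.ResolutionOfSingularities.ResolutionOfSingularities.Theorems.WildASPairLU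

end
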